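import Summits.MatrixMultiplication.MatrixMultiplication.Theorems.SoloBlindLift

/-!
# Fattening an element: the move that generates the extremal families of Conjecture E♭

Sub-programme (K₃) (Kraft inequality for zero-sum-free sequences over `𝔽₃`), H-good half.  Notation as in
`SoloBlindLift`: `E(τ; S) = ∑_{T ⊆ S, ∑_T h = τ} 2^{-|T|}` (`soloBlindMass`), `S·x` is the one-element
extension on `Option ι` (`none ↦ x`), and `B(ρ, c) = 1/2 + 2^{-ρ} - 2^{-(c+1-ρ)}` (`soloBlindEFlatBound`) is the
layer-defect bound of CONJECTURE E♭ (`E(σ; S) ≤ B(rank of the core, size of the core)`).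

FATTENING replaces the element `x` of `S·x` by two 'generic pieces' summing to it: in `G × ZMod 3` the family
`soloBlindFatten h x` takes the values `(h i, 0)` (`i ∈ S`), `x⁻ = (x, 2)` and `u = (0, 1)`, with `x⁻ + u = (x, 0)`.

* `soloBlindFatten_mass` — `E((σ,0); fattened) = E(σ; S) + E(σ - x; S) / 4`, against
  `E(σ; S·x) = E(σ; S) + E(σ - x; S) / 2` (`soloBlindLift_mass_insertNone`): the representations avoiding `x`
  are kept and every representation through `x` gets one element longer, so THE MASS THROUGH `x` IS HALVED
  (`soloBlindFatten_mass_eq`).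
* `soloBlindFatten_zsf`, `soloBlindFatten_hgood` — zero-sum freeness and H-goodness of `σ` survive (the last
  coordinate forces a zero-sum or `2σ`-subset to contain both pieces or neither).
* `soloBlindEFlatBound_fatten` — the core grows by one element and one dimension, and
  `B(ρ+1, c+1) = B(ρ, c) - 2^{-(ρ+1)}`; hence (`soloBlindFatten_slack`) the E♭-slack changes by
  `(through-mass of x - 2^{-ρ}) / 2`.  Consequences: if E♭ holds after fattening an E♭-extremal pair then the
  mass through `x` is at least `2^{-ρ}` (`soloBlindFatten_through_ge` — the LIGHT-ELEMENT inequality is a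
  corollary of E♭), and when the mass through `x` is exactly `2^{-ρ}` extremality is preserved
  (`soloBlindFatten_extremal_iff`) — this is how the E-tight pairs of the top layer generate E♭-extremal pairs
  on every layer below it (the chain family of K3.27 is the iterated fattening of a basis pair).
-/

set_option linter.dupNamespace false

namespace Summit.MatrixMultiplication.MatrixMultiplication.Theorems

open Finset

variable {ι : Type*} [DecidableEq ι]
variable {G : Type*} [AddCommGroup G] [DecidableEq G]

/-- Splitting a sum over `T ⊆ Option α` into the `none` part and the `some` part. -/
theorem soloBlindFatten_sum_option {α : Type*} [DecidableEq α] {M : Type*} [AddCommMonoid M]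
    (f : Option α → M) (T : Finset (Option α)) :
    ∑ o ∈ T, f o = (if none ∈ T then f none else 0) + ∑ a ∈ eraseNone T, f (some a) := by
  by_cases hn : none ∈ T
  · have hTeq : T = insertNone (eraseNone T) := by
      rw [insertNone_eraseNone, insert_eq_of_mem hn]
    rw [if_pos hn]
    calc ∑ o ∈ T, f o = ∑ o ∈ insertNone (eraseNone T), f o := by rw [← hTeq]
      _ = f none + ∑ a ∈ eraseNone T, f (some a) := by rw [sum_insertNone]
  · have hTeq : T = (eraseNone T).map Function.Embedding.some := by
      rw [map_some_eraseNone, erase_eq_of_notMem hn]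
    rw [if_neg hn, zero_add]
    calc ∑ o ∈ T, f o = ∑ o ∈ (eraseNone T).map Function.Embedding.some, f o := by rw [← hTeq]
      _ = ∑ a ∈ eraseNone T, f (some a) := by simp only [sum_map, Function.Embedding.some_apply]

/-- THE FATTENED FAMILY on `Option (Option ι)` with values in `G × ZMod 3`: `none ↦ u = (0, 1)`,
`some none ↦ x⁻ = (x, 2)`, `some (some i) ↦ (h i, 0)`; the two new pieces sum to `(x, 0)`. -/
def soloBlindFatten (h : ι → G) (x : G) : Option (Option ι) → G × ZMod 3 :=
  fun o => o.elim ((0 : G), (1 : ZMod 3))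
    (fun o' => o'.elim ((x : G), (2 : ZMod 3)) (fun i => (AddMonoidHom.inl G (ZMod 3)) (h i)))

omit [DecidableEq ι] [DecidableEq G] in
/-- Values of the fattened family. -/
theorem soloBlindFatten_apply_none (h : ι → G) (x : G) : soloBlindFatten h x none = (0, 1) := rfl

omit [DecidableEq ι] [DecidableEq G] in
/-- Values of the fattened family. -/
theorem soloBlindFatten_apply_some_none (h : ι → G) (x : G) :
    soloBlindFatten h x (some none) = (x, 2) := rfl

omit [DecidableEq ι] [DecidableEq G] in
/-- Values of the fattened family. -/
theorem soloBlindFatten_apply_some_some (h : ι → G) (x : G) (i : ι) :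
    soloBlindFatten h x (some (some i)) = (h i, 0) := rfl

omit [DecidableEq G] in
/-- The subset sums of the fattened family: with `U` the `S`-part of `T`,
`∑_T = ([x⁻ ∈ T]·x + ∑_U h, [u ∈ T]·1 + [x⁻ ∈ T]·2)`. -/
theorem soloBlindFatten_sum (h : ι → G) (x : G) (T : Finset (Option (Option ι))) :
    ∑ o ∈ T, soloBlindFatten h x o =
      ((if some none ∈ T then x else 0) + ∑ i ∈ eraseNone (eraseNone T), h i,
        (if none ∈ T then (1 : ZMod 3) else 0) + (if some none ∈ T then (2 : ZMod 3) else 0)) := by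
  rw [soloBlindFatten_sum_option, soloBlindFatten_sum_option]
  simp only [soloBlindFatten_apply_none, soloBlindFatten_apply_some_none, soloBlindFatten_apply_some_some,
    mem_eraseNone]
  ext
  · simp only [Prod.fst_add, Prod.fst_sum, apply_ite Prod.fst, Prod.fst_zero, ite_self, zero_add]
  · simp only [Prod.snd_add, Prod.snd_sum, apply_ite Prod.snd, Prod.snd_zero, sum_const_zero, add_zero]

omit [DecidableEq G] in
/-- The last coordinate of a subset sum vanishes iff the subset contains both new pieces or neither. -/
theorem soloBlindFatten_snd_eq_zero_iff (h : ι → G) (x : G) (T : Finset (Option (Option ι))) :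
    (∑ o ∈ T, soloBlindFatten h x o).2 = 0 ↔ (none ∈ T ↔ some none ∈ T) := by
  rw [soloBlindFatten_sum]
  by_cases h1 : none ∈ T <;> by_cases h2 : some none ∈ T <;> simp [h1, h2] <;> decide

omit [DecidableEq G] in
/-- THE FATTENED FAMILY IS ZERO-SUM FREE when `S·x` is: a zero-sum subset has last coordinate `0`, so it
contains both pieces (and then `x` together with its `S`-part is a zero-sum subset of `S·x`) or neither (and its
`S`-part is a zero-sum subset of `S`). -/
theorem soloBlindFatten_zsf (h : ι → G) (x : G) (S : Finset ι)
    (zsf : ∀ T ⊆ insertNone S, T.Nonempty → ∑ o ∈ T, (o.elim x h : G) ≠ 0) :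
    ∀ T ⊆ insertNone (insertNone S), T.Nonempty → ∑ o ∈ T, soloBlindFatten h x o ≠ 0 := by
  intro T hT hne e
  have hsnd := (soloBlindFatten_snd_eq_zero_iff h x T).mp (by rw [e]; rfl)
  have hfst := congrArg Prod.fst e
  rw [soloBlindFatten_sum, Prod.fst_zero] at hfst
  set U : Finset ι := eraseNone (eraseNone T) with hU
  have hUS : U ⊆ S := by
    intro i hi
    rw [hU, mem_eraseNone, mem_eraseNone] at hi
    exact some_mem_insertNone.mp (some_mem_insertNone.mp (hT hi))
  by_cases h2 : some none ∈ T
  · -- both pieces are in `T`: `x + ∑_U h = 0` contradicts zero-sum freeness of `S·x`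
    rw [if_pos h2] at hfst
    refine zsf (insertNone U) ?_ ⟨none, none_mem_insertNone⟩ ?_
    · intro o ho
      cases o with
      | none => exact none_mem_insertNone
      | some i => exact some_mem_insertNone.mpr (hUS (some_mem_insertNone.mp ho))
    · rw [sum_insertNone]
      simpa using hfst
  · -- neither piece is in `T`: `T` is the image of the nonempty `U ⊆ S`
    have h1 : none ∉ T := fun hn => h2 (hsnd.mp hn)
    rw [if_neg h2, zero_add] at hfst
    have hUne : U.Nonempty := by
      obtain ⟨o, ho⟩ := hne
      cases o with
      | none => exact absurd ho h1
      | some o' =>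
        cases o' with
        | none => exact absurd ho h2
        | some i => exact ⟨i, by rw [hU, mem_eraseNone, mem_eraseNone]; exact ho⟩
    refine zsf (U.map Function.Embedding.some) ?_ ?_ ?_
    · intro o ho
      rw [mem_map] at ho
      obtain ⟨i, hi, rfl⟩ := ho
      exact some_mem_insertNone.mpr (hUS hi)
    · obtain ⟨i, hi⟩ := hUne
      exact ⟨some i, mem_map_of_mem _ hi⟩
    · rw [sum_map]
      simpa using hfst

omit [DecidableEq G] in
/-- THE TARGET `(σ, 0)` STAYS H-GOOD: `(σ,0) + ∑_T` has last coordinate `0` only if `T` contains both pieces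
or neither, and then its first coordinate is `σ + ∑_{T'} ` for a subset `T'` of `S·x`. -/
theorem soloBlindFatten_hgood (h : ι → G) (x : G) (σ : G) (S : Finset ι)
    (hgood : ∀ T ⊆ insertNone S, σ + ∑ o ∈ T, (o.elim x h : G) ≠ 0) :
    ∀ T ⊆ insertNone (insertNone S), ((σ, 0) : G × ZMod 3) + ∑ o ∈ T, soloBlindFatten h x o ≠ 0 := by
  intro T hT e
  have hsnd : (∑ o ∈ T, soloBlindFatten h x o).2 = 0 := by
    have := congrArg Prod.snd e
    rw [Prod.snd_add, Prod.snd_zero] at this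
    simpa using this
  have hboth := (soloBlindFatten_snd_eq_zero_iff h x T).mp hsnd
  have hfst := congrArg Prod.fst e
  rw [Prod.fst_add, soloBlindFatten_sum, Prod.fst_zero] at hfst
  set U : Finset ι := eraseNone (eraseNone T) with hU
  have hUS : U ⊆ S := by
    intro i hi
    rw [hU, mem_eraseNone, mem_eraseNone] at hi
    exact some_mem_insertNone.mp (some_mem_insertNone.mp (hT hi))
  by_cases h2 : some none ∈ T
  · rw [if_pos h2] at hfst
    refine hgood (insertNone U) ?_ ?_
    · intro o ho
      cases o with
      | none => exact none_mem_insertNone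
      | some i => exact some_mem_insertNone.mpr (hUS (some_mem_insertNone.mp ho))
    · rw [sum_insertNone]
      simpa [add_assoc] using hfst
  · rw [if_neg h2, zero_add] at hfst
    refine hgood (U.map Function.Embedding.some) ?_ ?_
    · intro o ho
      rw [mem_map] at ho
      obtain ⟨i, hi, rfl⟩ := ho
      exact some_mem_insertNone.mpr (hUS hi)
    · rw [sum_map]
      simpa using hfst

/-- THE MASS OF THE FATTENED PAIR: `E((σ,0); fattened) = E(σ; S) + E(σ - x; S) / 4`. -/
theorem soloBlindFatten_mass (h : ι → G) (x σ : G) (S : Finset ι) :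
    soloBlindMass (soloBlindFatten h x) (insertNone (insertNone S)) (σ, 0) =
      soloBlindMass h S σ + soloBlindMass h S (σ - x) / 4 := by
  have hinj : Function.Injective (AddMonoidHom.inl G (ZMod 3)) := by
    intro a b e
    simpa using congrArg Prod.fst e
  have hout1 : ∀ g : G,
      (AddMonoidHom.inl G (ZMod 3)) g ≠ ((σ, 0) : G × ZMod 3) - ((x : G), (2 : ZMod 3)) := by
    intro g e
    have h2 := congrArg Prod.snd e
    change (0 : ZMod 3) = 0 - 2 at h2
    exact absurd h2 (by decide)
  have hout2 : ∀ g : G,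
      (AddMonoidHom.inl G (ZMod 3)) g ≠ ((σ, 0) : G × ZMod 3) - ((0 : G), (1 : ZMod 3)) := by
    intro g e
    have h2 := congrArg Prod.snd e
    change (0 : ZMod 3) = 0 - 1 at h2
    exact absurd h2 (by decide)
  have hsub : ((σ, (0 : ZMod 3)) : G × ZMod 3) - ((0 : G), (1 : ZMod 3)) - ((x : G), (2 : ZMod 3)) =
      (AddMonoidHom.inl G (ZMod 3)) (σ - x) := by
    refine Prod.ext ?_ ?_
    · change σ - 0 - x = σ - x
      rw [sub_zero]
    · change (0 : ZMod 3) - 1 - 2 = 0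
      decide
  have hσ : ((σ, (0 : ZMod 3)) : G × ZMod 3) = (AddMonoidHom.inl G (ZMod 3)) σ := rfl
  unfold soloBlindFatten
  rw [soloBlindLift_mass_insertNone, soloBlindLift_mass_insertNone, soloBlindLift_mass_insertNone,
    soloBlindLift_mass_eq_zero (AddMonoidHom.inl G (ZMod 3)) h S _ hout1,
    soloBlindLift_mass_eq_zero (AddMonoidHom.inl G (ZMod 3)) h S _ hout2, hsub,
    soloBlindLift_mass_map (AddMonoidHom.inl G (ZMod 3)) hinj h S (σ - x), hσ,
    soloBlindLift_mass_map (AddMonoidHom.inl G (ZMod 3)) hinj h S σ]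
  ring

/-- FATTENING HALVES THE MASS THROUGH `x`: `E((σ,0); fattened) = E(σ; S·x) - (E(σ - x; S) / 2) / 2`, where
`E(σ - x; S) / 2` is the mass of the representations of `σ` through `x`. -/
theorem soloBlindFatten_mass_eq (h : ι → G) (x σ : G) (S : Finset ι) :
    soloBlindMass (soloBlindFatten h x) (insertNone (insertNone S)) (σ, 0) =
      soloBlindMass (fun o : Option ι => o.elim x h) (insertNone S) σ - soloBlindMass h S (σ - x) / 2 / 2 := by
  rw [soloBlindFatten_mass, soloBlindLift_mass_insertNone]
  ring

/-- THE E♭ BOUND UNDER FATTENING: the core grows by one element and one dimension, and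
`B(ρ + 1, c + 1) = B(ρ, c) - 2^{-(ρ+1)}`. -/
theorem soloBlindEFlatBound_fatten (ρ c : ℕ) :
    soloBlindEFlatBound (ρ + 1) (c + 1) = soloBlindEFlatBound ρ c - (1 / 2 : ℚ) ^ (ρ + 1) := by
  unfold soloBlindEFlatBound
  have hc : c + 1 + 1 - (ρ + 1) = c + 1 - ρ := by omega
  rw [hc, pow_succ]
  ring

/-- THE SLACK BOOKKEEPING: the E♭-slack after fattening equals the slack before plus
`(through-mass of x - 2^{-ρ}) / 2`. -/
theorem soloBlindFatten_slack (h : ι → G) (x σ : G) (S : Finset ι) (ρ c : ℕ) :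
    soloBlindEFlatBound (ρ + 1) (c + 1) - soloBlindMass (soloBlindFatten h x) (insertNone (insertNone S)) (σ, 0) =
      (soloBlindEFlatBound ρ c - soloBlindMass (fun o : Option ι => o.elim x h) (insertNone S) σ) +
        (soloBlindMass h S (σ - x) / 2 - (1 / 2 : ℚ) ^ ρ) / 2 := by
  rw [soloBlindEFlatBound_fatten, soloBlindFatten_mass_eq, pow_succ]
  ring

/-- LIGHT ELEMENTS FROM E♭: if `(S·x, σ)` is E♭-extremal for the parameters `(ρ, c)` and E♭ holds for the
fattened pair with parameters `(ρ+1, c+1)`, then the mass through `x` is at least `2^{-ρ}`. -/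
theorem soloBlindFatten_through_ge (h : ι → G) (x σ : G) (S : Finset ι) (ρ c : ℕ)
    (hext : soloBlindMass (fun o : Option ι => o.elim x h) (insertNone S) σ = soloBlindEFlatBound ρ c)
    (hflat : soloBlindMass (soloBlindFatten h x) (insertNone (insertNone S)) (σ, 0) ≤
      soloBlindEFlatBound (ρ + 1) (c + 1)) :
    (1 / 2 : ℚ) ^ ρ ≤ soloBlindMass h S (σ - x) / 2 := by
  have key := soloBlindFatten_slack h x σ S ρ c
  rw [hext, sub_self, zero_add] at key
  linarith

/-- EXTREMALITY PROPAGATES ALONG LIGHT ELEMENTS: if the mass through `x` is exactly `2^{-ρ}`, the fattened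
pair is E♭-extremal for `(ρ+1, c+1)` iff the original pair is E♭-extremal for `(ρ, c)`. -/
theorem soloBlindFatten_extremal_iff (h : ι → G) (x σ : G) (S : Finset ι) (ρ c : ℕ)
    (hlight : soloBlindMass h S (σ - x) / 2 = (1 / 2 : ℚ) ^ ρ) :
    soloBlindMass (soloBlindFatten h x) (insertNone (insertNone S)) (σ, 0) =
        soloBlindEFlatBound (ρ + 1) (c + 1) ↔
      soloBlindMass (fun o : Option ι => o.elim x h) (insertNone S) σ = soloBlindEFlatBound ρ c := by
  have key := soloBlindFatten_slack h x σ S ρ c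
  rw [hlight, sub_self, zero_div, add_zero] at key
  constructor <;> intro H <;> linarith

/-- E♭ ITSELF IS FATTENING-MONOTONE AT LIGHT ELEMENTS: with through-mass exactly `2^{-ρ}`, E♭ for the
fattened pair is equivalent to E♭ for the original pair. -/
theorem soloBlindFatten_le_iff (h : ι → G) (x σ : G) (S : Finset ι) (ρ c : ℕ)
    (hlight : soloBlindMass h S (σ - x) / 2 = (1 / 2 : ℚ) ^ ρ) :
    soloBlindMass (soloBlindFatten h x) (insertNone (insertNone S)) (σ, 0) ≤
        soloBlindEFlatBound (ρ + 1) (c + 1) ↔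
      soloBlindMass (fun o : Option ι => o.elim x h) (insertNone S) σ ≤ soloBlindEFlatBound ρ c := by
  have key := soloBlindFatten_slack h x σ S ρ c
  rw [hlight, sub_self, zero_div, add_zero] at key
  constructor <;> intro H <;> linarith

end Summit.MatrixMultiplication.MatrixMultiplication.Theorems
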